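import Mathlib
import Summits.Schanuel.Schanuel.Theses.RigidCore
import Summits.Schanuel.Schanuel.Theorems.RigidCoreMinimalCounterexampleInAclMixedSelectorsAllRanks
import Summits.Schanuel.Schanuel.Theorems.RigidCoreMinimalCounterexampleInAclGlTransport
import Summits.Schanuel.Schanuel.Theorems.RigidCoreMinimalCounterexampleInAclMixedFrame

/-!
# The corank-one SELECTION DICHOTOMY of item stmt-Schanuel-14744 (crux stmt-Schanuel-0969 `RigidCore.MinimalCounterexampleInAcl`)

Line `kernel-arithmetic-selection` (lead prover-line-stmt-Schanuel-0969-c10-0), `--supports stmt-Schanuel-0969`; bookkeeping for the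
registered stub `stub_geThree` (= item stmt-Schanuel-14744, (S*) in the ranks `n ≥ 3`), corank-one sector.

At a first failure `x` of rank `n = m + 1` in a LOG FRAME `u_k = Σᵢ M_{ki} xᵢ` (`k < m`, ℚ-linearly independent integer combinations with
algebraic exponentials) every INTEGER DIRECTION `l ∈ ℤ^m` gives a further mixed direction `u_l = Σ_k l_k u_k = Σᵢ (Σ_k l_k M_{ki}) xᵢ`
(`e^{u_l} = ∏ (e^{u_k})^{l_k}` is algebraic, `isAlgebraic_cexp_intDir`).  The directions with `u_l ∈ acl^{ℂ_exp}(∅)` form a SATURATED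
SUBGROUP `G ≤ ℤ^m` (`exists_aclDirections`, `aclDirections_saturated`: `acl(∅)` is a subfield containing `ℚ`), and:

* `corankOne_expAcl_or_twoSided` — **DICHOTOMY**: either every coordinate of `x` lies in `acl(∅)` (when `G = ℤ^m`, by the acl-field
  criterion `firstFailure_mem_expAcl_of_intCombos`), or `G ≠ ⊤` and for EVERY direction `l ∉ G` — all integer directions off a proper
  saturated sublattice, in particular off one rational hyperplane — the hit set `{j ∈ ℤ : u_l + 2πij ∈ E_l}` of the value set
  `E_l = {Σᵢ (Σ_k l_k M_{ki}) x'ᵢ : x' ∈ locusMates x}` is unbounded above AND below (`intCombo_mem_expAcl_or_hits_unbounded`).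

So the corank-one residue of item 14744 is exactly "hit sets two-sided in every integral direction outside a proper sublattice": one-sided
(e.g. one-sided Beatty/Sturmian) hit families are harmless, and any `m` spanning one-sided directions already settle (S*) at `x`
(`mem_expAcl_of_corankOne_oneSided`, Theorems/…MixedSelectorsAllRanks).  Registered form: `stub_corankOneDichotomy`.

References: [KirbyMacintyreOnshuus2012] J. Kirby, A. Macintyre, A. Onshuus, *The algebraic numbers definable in various exponential
fields*, J. Inst. Math. Jussieu 11 (2012), arXiv:1101.4224, §2 (`ℤ`, `±2πi` are `∅`-definable in `ℂ_exp`); [Kirby2010] J. Kirby,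
*Exponential algebraicity in exponential fields*, Bull. LMS 42 (2010), arXiv:0810.4285, Prop. 7.2.
-/

noncomputable section

set_option linter.dupNamespace false

open Complex Set FirstOrder

namespace Summit.Schanuel.Schanuel.Cruxes.MinimalCounterexampleInAcl.KernelArithmeticSelection

open Literature.NumberTheory.Transcendental (SchanuelRank)
open Literature.ModelTheory.ExponentialFields
open Summit.Schanuel.Schanuel.Theorems.AclSubsetLogFreeCore.Negative

variable {n m : ℕ}

/-! ## Integer directions in a log frame -/

/-- The integer direction `l` of the frame `M` evaluated at `x`: `Σᵢ (Σ_k l_k M_{ki}) xᵢ = Σ_k l_k (Σᵢ M_{ki} xᵢ)`. [folklore] -/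
theorem intDir_sum (x : Fin n → ℂ) (M : Fin m → Fin n → ℤ) (l : Fin m → ℤ) :
    (∑ i, ((∑ k, l k * M k i : ℤ) : ℂ) * x i) = ∑ k, (l k : ℂ) * ∑ i, (M k i : ℂ) * x i := by
  simp only [Int.cast_sum, Int.cast_mul, Finset.sum_mul, Finset.mul_sum]
  rw [Finset.sum_comm]
  exact Finset.sum_congr rfl fun k _ => Finset.sum_congr rfl fun i _ => by ring

/-- In a log frame (`e^{Σᵢ M_{ki} xᵢ}` algebraic for every `k`) every integer direction has an algebraic exponential:
`e^{u_l} = ∏_k (e^{u_k})^{l_k}`. [folklore] -/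
theorem isAlgebraic_cexp_intDir (x : Fin n → ℂ) (M : Fin m → Fin n → ℤ)
    (halg : ∀ k, IsAlgebraic ℚ (cexp (∑ i, (M k i : ℂ) * x i))) (l : Fin m → ℤ) :
    IsAlgebraic ℚ (cexp (∑ i, ((∑ k, l k * M k i : ℤ) : ℂ) * x i)) := by
  rw [intDir_sum, cexp_intSum]
  exact mem_algebraicClosure_iff.1
    (prod_mem fun k _ => zpow_mem (mem_algebraicClosure_iff.2 (halg k)) (l k))

/-- The directions `l` with `u_l ∈ acl^{ℂ_exp}(∅)` form a subgroup of `ℤ^m` (stated as the existence of a `ℤ`-submodule with this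
carrier, so that the file introduces no definition): `acl(∅)` is an additive subgroup of `ℂ` containing `ℤ` and closed under
multiplication. [cite: KirbyMacintyreOnshuus2012, §2] -/
theorem exists_aclDirections (x : Fin n → ℂ) (M : Fin m → Fin n → ℤ) :
    ∃ G : Submodule ℤ (Fin m → ℤ), ∀ l : Fin m → ℤ,
      l ∈ G ↔ (∑ i, ((∑ k, l k * M k i : ℤ) : ℂ) * x i) ∈ expAcl := by
  refine ⟨{ carrier := {l | (∑ i, ((∑ k, l k * M k i : ℤ) : ℂ) * x i) ∈ expAcl}
            add_mem' := ?_, zero_mem' := ?_, smul_mem' := ?_ }, fun _ => Iff.rfl⟩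
  · intro l l' hl hl'
    simp only [Set.mem_setOf_eq, intDir_sum] at hl hl' ⊢
    simp only [Pi.add_apply, Int.cast_add]
    rw [show (∑ k, ((l k : ℂ) + (l' k : ℂ)) * ∑ i, (M k i : ℂ) * x i) =
        (∑ k, (l k : ℂ) * ∑ i, (M k i : ℂ) * x i) + ∑ k, (l' k : ℂ) * ∑ i, (M k i : ℂ) * x i from by
      rw [← Finset.sum_add_distrib]; exact Finset.sum_congr rfl fun k _ => by ring]
    exact add_mem_expAcl hl hl'
  · simp only [Set.mem_setOf_eq, intDir_sum, Pi.zero_apply, Int.cast_zero, zero_mul, Finset.sum_const_zero]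
    simpa using intCast_mem_expAcl 0
  · intro c l hl
    simp only [Set.mem_setOf_eq, intDir_sum] at hl ⊢
    simp only [Pi.smul_apply, smul_eq_mul, Int.cast_mul]
    rw [show (∑ k, (c : ℂ) * (l k : ℂ) * ∑ i, (M k i : ℂ) * x i) = (c : ℂ) * ∑ k, (l k : ℂ) * ∑ i, (M k i : ℂ) * x i from by
      rw [Finset.mul_sum]; exact Finset.sum_congr rfl fun k _ => by ring]
    exact mul_mem_expAcl (intCast_mem_expAcl c) hl

/-- The subgroup of `acl(∅)`-directions is SATURATED: `d ≠ 0` and `d • l ∈ G` imply `l ∈ G` (divide by `d` inside the field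
`acl(∅) ⊇ ℚ`). [cite: KirbyMacintyreOnshuus2012, §2] -/
theorem aclDirections_saturated (x : Fin n → ℂ) (M : Fin m → Fin n → ℤ) {G : Submodule ℤ (Fin m → ℤ)}
    (hG : ∀ l : Fin m → ℤ, l ∈ G ↔ (∑ i, ((∑ k, l k * M k i : ℤ) : ℂ) * x i) ∈ expAcl)
    {d : ℤ} (hd : d ≠ 0) (l : Fin m → ℤ) (h : d • l ∈ G) : l ∈ G := by
  rw [hG] at h ⊢
  rw [intDir_sum] at h ⊢
  have e : (∑ k, ((d • l) k : ℂ) * ∑ i, (M k i : ℂ) * x i) = (d : ℂ) * ∑ k, (l k : ℂ) * ∑ i, (M k i : ℂ) * x i := by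
    rw [Finset.mul_sum]
    exact Finset.sum_congr rfl fun k _ => by simp only [Pi.smul_apply, smul_eq_mul, Int.cast_mul]; ring
  rw [e] at h
  have hd' : (d : ℂ) ≠ 0 := Int.cast_ne_zero.2 hd
  have := mul_mem_expAcl (inv_mem_expAcl (intCast_mem_expAcl d)) h
  rwa [inv_mul_cancel_left₀ hd'] at this

/-! ## The dichotomy -/

/-- **CORANK-ONE SELECTION DICHOTOMY (every rank).**  Let `x` be a first failure of rank `n = m + 1` and `u_k = Σᵢ M_{ki} xᵢ`
(`k < m`) ℚ-linearly independent integer combinations with algebraic exponentials (a log frame of the corank-one mixed sector).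
Then EITHER every coordinate of `x` lies in `acl^{ℂ_exp}(∅)`, OR the saturated subgroup `G = {l : u_l ∈ acl(∅)}` of `ℤ^m` is proper and
for every integer direction `l ∉ G` the hit set `{j ∈ ℤ : u_l + 2πij ∈ E_l}` of the value set of `u_l` on the mates is unbounded above
and below.  Proof: if `G = ⊤` the frame directions are in `acl(∅)` and the acl-field criterion (`SchanuelRank m`) applies; if `l ∉ G`
the every-rank dichotomy for the mixed direction `Σ_k l_k M_k` applies. [cite: Kirby2010, Prop. 7.2] -/
theorem corankOne_expAcl_or_twoSided {x : Fin n → ℂ} (hx : x ∈ firstFailures n) (hmn : n = m + 1)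
    (M : Fin m → Fin n → ℤ) (hli : LinearIndependent ℚ (fun k => ∑ i, (M k i : ℂ) * x i))
    (halg : ∀ k, IsAlgebraic ℚ (cexp (∑ i, (M k i : ℂ) * x i))) :
    (∀ i, x i ∈ expAcl) ∨
      ∃ G : Submodule ℤ (Fin m → ℤ), G ≠ ⊤ ∧
        (∀ l : Fin m → ℤ, l ∈ G ↔ (∑ i, ((∑ k, l k * M k i : ℤ) : ℂ) * x i) ∈ expAcl) ∧
        (∀ (d : ℤ) (l : Fin m → ℤ), d ≠ 0 → d • l ∈ G → l ∈ G) ∧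
        ∀ l : Fin m → ℤ, l ∉ G →
          ¬ BddBelow {j : ℤ | (∑ i, ((∑ k, l k * M k i : ℤ) : ℂ) * x i) + 2 * ↑Real.pi * I * (j : ℂ) ∈
              {s : ℂ | ∃ x' ∈ locusMates x, s = ∑ i, ((∑ k, l k * M k i : ℤ) : ℂ) * x' i}} ∧
          ¬ BddAbove {j : ℤ | (∑ i, ((∑ k, l k * M k i : ℤ) : ℂ) * x i) + 2 * ↑Real.pi * I * (j : ℂ) ∈
              {s : ℂ | ∃ x' ∈ locusMates x, s = ∑ i, ((∑ k, l k * M k i : ℤ) : ℂ) * x' i}} := by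
  classical
  obtain ⟨G, hG⟩ := exists_aclDirections x M
  by_cases htop : G = ⊤
  · -- every frame direction is in `acl(∅)`: the acl-field criterion
    left
    refine firstFailure_mem_expAcl_of_intCombos hx hmn M hli fun k => ?_
    have hk : (Pi.single k (1 : ℤ) : Fin m → ℤ) ∈ G := htop ▸ Submodule.mem_top
    rw [hG, intDir_sum] at hk
    rwa [Finset.sum_eq_single k (fun b _ hb => by simp [hb])
      (fun h => absurd (Finset.mem_univ k) h), Pi.single_eq_same, Int.cast_one, one_mul] at hk
  · right
    refine ⟨G, htop, hG, fun d l hd h => aclDirections_saturated x M hG hd l h, fun l hl => ?_⟩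
    rcases intCombo_mem_expAcl_or_hits_unbounded hx.1 (fun i => ∑ k, l k * M k i) (isAlgebraic_cexp_intDir x M halg l)
      with h | h
    · exact absurd ((hG l).2 h) hl
    · exact h

/-- **Corollary (contrapositive of the one-sided selector, every rank).**  If some coordinate of the corank-one first failure `x` is NOT in
`acl(∅)`, then some integer direction of the frame has a hit set unbounded above and below (take any `l` outside the proper subgroup
`G`, e.g. a frame vector). [cite: Kirby2010, Prop. 7.2] -/
theorem exists_twoSided_of_not_expAcl {x : Fin n → ℂ} (hx : x ∈ firstFailures n) (hmn : n = m + 1)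
    (M : Fin m → Fin n → ℤ) (hli : LinearIndependent ℚ (fun k => ∑ i, (M k i : ℂ) * x i))
    (halg : ∀ k, IsAlgebraic ℚ (cexp (∑ i, (M k i : ℂ) * x i))) (hnot : ¬ ∀ i, x i ∈ expAcl) :
    ∃ l : Fin m → ℤ,
      ¬ BddBelow {j : ℤ | (∑ i, ((∑ k, l k * M k i : ℤ) : ℂ) * x i) + 2 * ↑Real.pi * I * (j : ℂ) ∈
          {s : ℂ | ∃ x' ∈ locusMates x, s = ∑ i, ((∑ k, l k * M k i : ℤ) : ℂ) * x' i}} ∧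
      ¬ BddAbove {j : ℤ | (∑ i, ((∑ k, l k * M k i : ℤ) : ℂ) * x i) + 2 * ↑Real.pi * I * (j : ℂ) ∈
          {s : ℂ | ∃ x' ∈ locusMates x, s = ∑ i, ((∑ k, l k * M k i : ℤ) : ℂ) * x' i}} := by
  rcases corankOne_expAcl_or_twoSided hx hmn M hli halg with h | ⟨G, hGtop, -, -, htwo⟩
  · exact absurd h hnot
  · obtain ⟨l, hl⟩ : ∃ l : Fin m → ℤ, l ∉ G := by
      by_contra h
      push Not at h
      exact hGtop (eq_top_iff.2 fun l _ => h l)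
    exact ⟨l, htwo l hl⟩

/-! ## Registered form (fully qualified) -/

/-- Registered form of `corankOne_expAcl_or_twoSided` (stub `stub_corankOneDichotomy` of crux stmt-Schanuel-0969, line
kernel-arithmetic-selection, lead c10): the corank-one selection dichotomy at every rank. [cite: Kirby2010, Prop. 7.2] -/
theorem stub_corankOneDichotomy : ∀ (n m : ℕ) (x : Fin n → ℂ), x ∈ Summit.Schanuel.Schanuel.Cruxes.MinimalCounterexampleInAcl.KernelArithmeticSelection.firstFailures n → n = m + 1 → ∀ (M : Fin m → Fin n → ℤ), LinearIndependent ℚ (fun k => ∑ i, (M k i : ℂ) * x i) → (∀ k, IsAlgebraic ℚ (Complex.exp (∑ i, (M k i : ℂ) * x i))) → ((∀ i, x i ∈ Summit.Schanuel.Schanuel.Theorems.AclSubsetLogFreeCore.Negative.expAcl) ∨ ∃ G : Submodule ℤ (Fin m → ℤ), G ≠ ⊤ ∧ (∀ l : Fin m → ℤ, l ∈ G ↔ (∑ i, ((∑ k, l k * M k i : ℤ) : ℂ) * x i) ∈ Summit.Schanuel.Schanuel.Theorems.AclSubsetLogFreeCore.Negative.expAcl) ∧ (∀ (d : ℤ)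 (l : Fin m → ℤ), d ≠ 0 → d • l ∈ G → l ∈ G) ∧ ∀ l : Fin m → ℤ, l ∉ G → ¬ BddBelow {j : ℤ | (∑ i, ((∑ k, l k * M k i : ℤ) : ℂ) * x i) + 2 * ↑Real.pi * Complex.I * (j : ℂ) ∈ {s : ℂ | ∃ x' ∈ Summit.Schanuel.Schanuel.Cruxes.MinimalCounterexampleInAcl.KernelArithmeticSelection.locusMates x, s = ∑ i, ((∑ k, l k * M k i : ℤ) : ℂ) * x' i}} ∧ ¬ BddAbove {j : ℤ | (∑ i, ((∑ k, l k * M k i : ℤ) : ℂ) * x i) + 2 * ↑Real.pi * Complex.I * (j : ℂ) ∈ {s : ℂ | ∃ x' ∈ Summit.Schanuel.Schanuel.Cruxes.MinimalCounterexampleInAcl.KernelArithmeticSelection.locusMates x, s = ∑ i, ((∑ k, l k * M k i : ℤ) : ℂ) * x' i}}) :=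
  fun _ _ _ hx hmn M hli halg => corankOne_expAcl_or_twoSided hx hmn M hli halg

end Summit.Schanuel.Schanuel.Cruxes.MinimalCounterexampleInAcl.KernelArithmeticSelection

end
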